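import Mathlib
import Literature.Analysis.FluidPDE.SuitableWeak
import Summits.NavierStokesRegularity.NavierStokesRegularity.Theorems.EulerZoomLiouvillePowerGaugeEulerLiouvilleSpacePeriodic
import Summits.NavierStokesRegularity.NavierStokesRegularity.Theorems.EulerZoomLiouvillePowerGaugeEulerLiouvilleScrewSymmetric
import Summits.NavierStokesRegularity.NavierStokesRegularity.Theorems.EulerZoomLiouvillePowerGaugeEulerLiouvilleAllRhoStrata
import HarnessLib

/-!
# Crux E `PowerGaugeEulerLiouville` (stmt-NavierStokesRegularity-19832): members whose PAST is spatially periodic or screw-symmetric are trivial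

Route `EulerZoomLiouville` (NavierStokesRegularity), crux E = Seregin's power-gauged ancient-Euler Liouville
statement.  The tree's whole-slab strata `powerGaugeEulerLiouville_spacePeriodic` (`…SpacePeriodic.lean`) and
`powerGaugeEulerLiouville_screwSymmetric` (`…ScrewSymmetric.lean`) assume the symmetry on EVERY slice `τ < 0`.
Their slice lemmas (`SpacePeriodic.slice_ball_eq_zero_of_periodic`, `ScrewSymmetric.slice_ball_eq_zero_of_screw`)
use only the `A`-gauge on the one slice, so the symmetry is only needed in the FAR PAST: a member whose slices
`τ < T₁` (`T₁ ≤ 0`; NOTHING assumed on `[T₁, 0)`) are periodic in a space direction, or have screw-symmetric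
modulus `|u(τ, L(y−y₀)+y₀+w)| = |u(τ, y)|` (`L w = w ≠ 0`), has `∫ |u(τ)|² = 0` for every `τ < T₁`, hence an
energy-quiescent past, hence vanishes on the whole slab by the class's backward energy monotonicity
(`ae_eq_zero_of_gauge_of_energyVanishing_allRho`) — `PastSymmetric.ae_eq_zero_of_gauge_of_pastSpacePeriodic`,
`PastSymmetric.ae_eq_zero_of_gauge_of_pastScrewSymmetric`, through the generic
`PastSymmetric.ae_eq_zero_of_gauge_of_pastSlicesZero` («a.e. slice before `T₁` has zero energy ⇒ trivial»).
WHAT THIS IS NOT: not NS regularity, not the crux `E` — WEAK past strata of it for the lead skeleton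
`Cruxes/PowerGaugeEulerLiouville/Lines/birth.lean` (interim LEAD ns-typeII-p2 g9).
-/

noncomputable section

set_option linter.dupNamespace false

open MeasureTheory Set Filter Topology Metric Function TopologicalSpace
open scoped ENNReal NNReal

namespace Summit.NavierStokesRegularity.NavierStokesRegularity.Theorems.PowerGaugeEulerLiouville.PastSymmetric

open Literature.Analysis Literature.Analysis.FunctionSpaces Literature.Analysis.FluidPDE

/-- **Zero-energy slices in the far past ⇒ trivial** (every `ρ ≥ 0`): if a.e. slice `τ < T₁` of a member of
the power-gauged class has `∫ |u(τ)|² = 0`, the member vanishes a.e. on the slab — the set of quiescent times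
below `−N` has infinite measure, so `ae_eq_zero_of_gauge_of_energyVanishing_allRho` applies. [folklore] -/
theorem ae_eq_zero_of_gauge_of_pastSlicesZero {ρ : ℝ} (hρ : 0 ≤ ρ)
    {u : ℝ → EuclideanSpace ℝ (Fin 3) → EuclideanSpace ℝ (Fin 3)} {p : ℝ → EuclideanSpace ℝ (Fin 3) → ℝ}
    {H : ℝ → EuclideanSpace ℝ (Fin 3) → EuclideanSpace ℝ (Fin 3) →L[ℝ] EuclideanSpace ℝ (Fin 3)} {c : ℝ≥0}
    (hsw : IsSuitableWeakSolutionOn (slab (EuclideanSpace ℝ (Fin 3)) (Iio 0) isOpen_Iio) 0 0 u p)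
    (hH : HasWeakSpatialGradientOn (slab (EuclideanSpace ℝ (Fin 3)) (Iio 0) isOpen_Iio) u H)
    (hc : ∀ a : ℝ, 0 < a → ENNReal.ofReal (a ^ (2 * ρ)) * cknA a (0 : ℝ × EuclideanSpace ℝ (Fin 3)) u +
        ENNReal.ofReal (a ^ ρ) * cknE a (0 : ℝ × EuclideanSpace ℝ (Fin 3)) H +
        ENNReal.ofReal (a ^ (2 * ρ)) * cknD a (0 : ℝ × EuclideanSpace ℝ (Fin 3)) p ≤ (c : ℝ≥0∞))
    {T₁ : ℝ} (hzero : ∀ᵐ τ ∂(volume.restrict (Iio T₁)), ∫⁻ x, ‖u τ x‖ₑ ^ 2 = 0) :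
    uncurry u =ᵐ[volume.restrict (Iio (0 : ℝ) ×ˢ (univ : Set (EuclideanSpace ℝ (Fin 3))))] 0 := by
  refine ae_eq_zero_of_gauge_of_energyVanishing_allRho hρ hsw hH hc fun ε _ N => ?_
  have hnull : volume ({τ : ℝ | ¬ ∫⁻ x, ‖u τ x‖ₑ ^ 2 = 0} ∩ Iio T₁) = 0 := by
    have h := hzero
    rw [ae_iff, Measure.restrict_apply' measurableSet_Iio] at h
    exact h
  set m : ℝ := min (-N) T₁ with hm
  intro h0
  have hsub : Iio m ⊆ {s : ℝ | s < -N ∧ ∫⁻ x, ‖u s x‖ₑ ^ 2 ≤ ENNReal.ofReal ε} ∪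
      ({τ : ℝ | ¬ ∫⁻ x, ‖u τ x‖ₑ ^ 2 = 0} ∩ Iio T₁) := by
    intro s hs
    have hsN : s < -N := lt_of_lt_of_le hs (min_le_left _ _)
    have hsT : s < T₁ := lt_of_lt_of_le hs (min_le_right _ _)
    by_cases hz : ∫⁻ x, ‖u s x‖ₑ ^ 2 = 0
    · left
      refine ⟨hsN, ?_⟩
      rw [hz]
      exact zero_le
    · right
      exact ⟨hz, hsT⟩
  have h2 : volume (Iio m) ≤ 0 :=
    calc volume (Iio m) ≤ volume ({s : ℝ | s < -N ∧ ∫⁻ x, ‖u s x‖ₑ ^ 2 ≤ ENNReal.ofReal ε} ∪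
          ({τ : ℝ | ¬ ∫⁻ x, ‖u τ x‖ₑ ^ 2 = 0} ∩ Iio T₁)) := measure_mono hsub
      _ ≤ volume {s : ℝ | s < -N ∧ ∫⁻ x, ‖u s x‖ₑ ^ 2 ≤ ENNReal.ofReal ε} +
          volume ({τ : ℝ | ¬ ∫⁻ x, ‖u τ x‖ₑ ^ 2 = 0} ∩ Iio T₁) := measure_union_le _ _
      _ = 0 := by rw [h0, hnull, add_zero]
  rw [Real.volume_Iio] at h2
  exact absurd h2 (by simp)

/-- `ℝ³` is exhausted by the balls `B(y₀, n+1)`. [folklore] -/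
theorem iUnion_ball_natCast_succ (y₀ : EuclideanSpace ℝ (Fin 3)) :
    (⋃ n : ℕ, ball y₀ ((n : ℝ) + 1)) = (univ : Set (EuclideanSpace ℝ (Fin 3))) := by
  refine eq_univ_of_forall fun x => ?_
  obtain ⟨n, hn⟩ := exists_nat_gt (dist x y₀)
  exact mem_iUnion.2 ⟨n, by rw [mem_ball]; linarith⟩

/-- If `∫_{B(y₀, R)} g = 0` for every `R > 0` then `∫ g = 0`. [folklore] -/
theorem lintegral_eq_zero_of_forall_ball (g : EuclideanSpace ℝ (Fin 3) → ℝ≥0∞) (y₀ : EuclideanSpace ℝ (Fin 3))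
    (h : ∀ R : ℝ, 0 < R → ∫⁻ x in ball y₀ R, g x = 0) : ∫⁻ x, g x = 0 := by
  refine le_antisymm ?_ zero_le
  calc ∫⁻ x, g x = ∫⁻ x in (⋃ n : ℕ, ball y₀ ((n : ℝ) + 1)), g x := by
        rw [iUnion_ball_natCast_succ, Measure.restrict_univ]
    _ ≤ ∑' n : ℕ, ∫⁻ x in ball y₀ ((n : ℝ) + 1), g x := lintegral_iUnion_le _ _
    _ = 0 := by
        have h0 : ∀ n : ℕ, ∫⁻ x in ball y₀ ((n : ℝ) + 1), g x = 0 := fun n => h _ (by positivity)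
        simp only [h0, tsum_zero]

/-- **Members whose FAR PAST is periodic in a space direction are trivial.**  If `u(τ, y + v) = u(τ, y)` for
every `τ < T₁` (`T₁ ≤ 0`, `v ≠ 0`) — nothing assumed on `[T₁, 0)` — then `u = 0` a.e. on the slab: each such slice
vanishes by `SpacePeriodic.slice_ball_eq_zero_of_periodic` (the `A`-gauge and packing), so the past is
energy-quiescent (`ae_eq_zero_of_gauge_of_pastSlicesZero`).  The tree's `powerGaugeEulerLiouville_spacePeriodic` is
`T₁ = 0`. [folklore] -/
theorem ae_eq_zero_of_gauge_of_pastSpacePeriodic {ρ : ℝ} (hρ : 0 < ρ)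
    {u : ℝ → EuclideanSpace ℝ (Fin 3) → EuclideanSpace ℝ (Fin 3)} {p : ℝ → EuclideanSpace ℝ (Fin 3) → ℝ}
    {H : ℝ → EuclideanSpace ℝ (Fin 3) → EuclideanSpace ℝ (Fin 3) →L[ℝ] EuclideanSpace ℝ (Fin 3)} {c : ℝ≥0}
    (hsw : IsSuitableWeakSolutionOn (slab (EuclideanSpace ℝ (Fin 3)) (Iio 0) isOpen_Iio) 0 0 u p)
    (hH : HasWeakSpatialGradientOn (slab (EuclideanSpace ℝ (Fin 3)) (Iio 0) isOpen_Iio) u H)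
    (hc : ∀ a : ℝ, 0 < a → ENNReal.ofReal (a ^ (2 * ρ)) * cknA a (0 : ℝ × EuclideanSpace ℝ (Fin 3)) u +
        ENNReal.ofReal (a ^ ρ) * cknE a (0 : ℝ × EuclideanSpace ℝ (Fin 3)) H +
        ENNReal.ofReal (a ^ (2 * ρ)) * cknD a (0 : ℝ × EuclideanSpace ℝ (Fin 3)) p ≤ (c : ℝ≥0∞))
    {T₁ : ℝ} (hT₁ : T₁ ≤ 0) {v : EuclideanSpace ℝ (Fin 3)} (hv : v ≠ 0)
    (hper : ∀ τ : ℝ, τ < T₁ → ∀ y : EuclideanSpace ℝ (Fin 3), u τ (y + v) = u τ y) :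
    uncurry u =ᵐ[volume.restrict (Iio (0 : ℝ) ×ˢ (univ : Set (EuclideanSpace ℝ (Fin 3))))] 0 := by
  have hA : ∀ a : ℝ, 0 < a → ENNReal.ofReal (a ^ (2 * ρ)) *
      cknA a (0 : ℝ × EuclideanSpace ℝ (Fin 3)) u ≤ (c : ℝ≥0∞) :=
    fun a ha => le_trans (le_trans le_self_add le_self_add) (hc a ha)
  refine ae_eq_zero_of_gauge_of_pastSlicesZero hρ.le hsw hH hc (T₁ := T₁) ?_
  rw [ae_restrict_iff' measurableSet_Iio]
  refine Eventually.of_forall fun τ hτ => ?_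
  have hτ0 : τ < 0 := lt_of_lt_of_le hτ hT₁
  exact lintegral_eq_zero_of_forall_ball _ 0 fun R hR =>
    SpacePeriodic.slice_ball_eq_zero_of_periodic hρ hA hv hτ0 (hper τ hτ) hR

/-- **Members whose FAR PAST has screw-symmetric modulus are trivial.**  If
`‖u(τ, L(y − y₀) + y₀ + w)‖ = ‖u(τ, y)‖` for every `τ < T₁` and `y` (`T₁ ≤ 0`; `L` a linear isometry with
`L w = w`, `w ≠ 0`: screw motions, pure translations `L = 1`, glide reflections) — nothing assumed on `[T₁, 0)` —
then `u = 0` a.e. on the slab (`ScrewSymmetric.slice_ball_eq_zero_of_screw` on each past slice, then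
`ae_eq_zero_of_gauge_of_pastSlicesZero`).  The tree's `powerGaugeEulerLiouville_screwSymmetric` is `T₁ = 0`. [folklore] -/
theorem ae_eq_zero_of_gauge_of_pastScrewSymmetric {ρ : ℝ} (hρ : 0 < ρ)
    {u : ℝ → EuclideanSpace ℝ (Fin 3) → EuclideanSpace ℝ (Fin 3)} {p : ℝ → EuclideanSpace ℝ (Fin 3) → ℝ}
    {H : ℝ → EuclideanSpace ℝ (Fin 3) → EuclideanSpace ℝ (Fin 3) →L[ℝ] EuclideanSpace ℝ (Fin 3)} {c : ℝ≥0}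
    (hsw : IsSuitableWeakSolutionOn (slab (EuclideanSpace ℝ (Fin 3)) (Iio 0) isOpen_Iio) 0 0 u p)
    (hH : HasWeakSpatialGradientOn (slab (EuclideanSpace ℝ (Fin 3)) (Iio 0) isOpen_Iio) u H)
    (hc : ∀ a : ℝ, 0 < a → ENNReal.ofReal (a ^ (2 * ρ)) * cknA a (0 : ℝ × EuclideanSpace ℝ (Fin 3)) u +
        ENNReal.ofReal (a ^ ρ) * cknE a (0 : ℝ × EuclideanSpace ℝ (Fin 3)) H +
        ENNReal.ofReal (a ^ (2 * ρ)) * cknD a (0 : ℝ × EuclideanSpace ℝ (Fin 3)) p ≤ (c : ℝ≥0∞))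
    {T₁ : ℝ} (hT₁ : T₁ ≤ 0) (L : EuclideanSpace ℝ (Fin 3) ≃ₗᵢ[ℝ] EuclideanSpace ℝ (Fin 3))
    {y₀ w : EuclideanSpace ℝ (Fin 3)} (hw : w ≠ 0) (hLw : L w = w)
    (hsym : ∀ τ : ℝ, τ < T₁ → ∀ y : EuclideanSpace ℝ (Fin 3), ‖u τ (L (y - y₀) + y₀ + w)‖ = ‖u τ y‖) :
    uncurry u =ᵐ[volume.restrict (Iio (0 : ℝ) ×ˢ (univ : Set (EuclideanSpace ℝ (Fin 3))))] 0 := by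
  have hA : ∀ a : ℝ, 0 < a → ENNReal.ofReal (a ^ (2 * ρ)) *
      cknA a (0 : ℝ × EuclideanSpace ℝ (Fin 3)) u ≤ (c : ℝ≥0∞) :=
    fun a ha => le_trans (le_trans le_self_add le_self_add) (hc a ha)
  refine ae_eq_zero_of_gauge_of_pastSlicesZero hρ.le hsw hH hc (T₁ := T₁) ?_
  rw [ae_restrict_iff' measurableSet_Iio]
  refine Eventually.of_forall fun τ hτ => ?_
  have hτ0 : τ < 0 := lt_of_lt_of_le hτ hT₁
  exact lintegral_eq_zero_of_forall_ball _ y₀ fun R hR =>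
    ScrewSymmetric.slice_ball_eq_zero_of_screw hρ hA L hw hLw hτ0 (hsym τ hτ) hR

end Summit.NavierStokesRegularity.NavierStokesRegularity.Theorems.PowerGaugeEulerLiouville.PastSymmetric
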